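import Literature.NumberTheory.Transcendental.NewPointsScaled
import HarnessLib

/-!
# Two-base envelopes for the numerical condition of Baker's method on `M_κ`

Topic: `Literature/NumberTheory/Transcendental`. Plan item W4 (parameter choice, part 2a) of
the unit `provefact-Literature.NumberTheory.Transcendental.H-b596640137`. Every factor of the
left-hand side of `NewPointsScaled.NumCond₂` is bounded by a TWO-BASE ENVELOPE `G^{N₁} · W^{N₂}`
with NATURAL exponents `N₁, N₂` (explicit polynomials in the parameters), where
`G = BakerData.bigConst` dominates all constants of the datum (`|d₁|`, `M`, `h_B`, `max(1,q_B)`,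
`dd+1`, `C_K`, `e^{C_Θ}`, `1/c_Θ`, `e^{C'_Θ}`, `X+1`, `‖v‖+1`) and `W ≥ 1` dominates the linear
sizes `2D'`, `T`, `S₀+1`, `S₁+1`, `D·hdeg + 2T + 1`. Along the parameter family
(`ParameterFamily.lean`) `W` is a power of `σ` and `G ≤ σ`, so that `NumCond₂` reduces to an
inequality between ℕ-polynomials in `σ` (sequel). PROVED here: `bigConst` and its domination
lemmas, and the envelopes of `houseBound`, `siegelHouseBound` (`q ≥ 2p`), `houseXi`,
`lineValBound`, `|d_s|^E`, `k!(kX+1)^k`, the growth factor, and the right-hand side.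

## References

* A. Baker, G. Wüstholz, *Logarithmic Forms and Diophantine Geometry*, CUP 2007, §6.8 (p. 119).
-/

noncomputable section

open Complex MvPolynomial Finset NumberField
open scoped PeriodPair

namespace Literature.NumberTheory.Transcendental

namespace GaGmE

namespace Std

namespace BakerData

variable {β γ δ : Type} [Fintype β] [Fintype γ] [Fintype δ] [DecidableEq γ]
variable (B : BakerData β γ δ)

/-! ### The big constant -/

/-- **The big constant** `G ≥ 2` dominating every constant of the datum that enters `NumCond₂`.
[folklore] -/
def bigConst : ℝ :=
  2 + |(B.d₁ : ℝ)| + B.M + B.hB + max 1 B.qB + ((B.dd : ℝ) + 1) + siegelConst B.K +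
    Real.exp (thetaGrowthC (β := β) B.L B.κM) + B.thetaLowc⁻¹ + Real.exp B.thetaLowC +
    (B.dirNorm + 1) + (‖B.v‖ + 1)

/-- The summands of `G` are non-negative; `G` dominates each of them and `G ≥ 2`. [folklore] -/
theorem bigConst_spec :
    2 ≤ B.bigConst ∧ |(B.d₁ : ℝ)| ≤ B.bigConst ∧ B.M ≤ B.bigConst ∧ B.hB ≤ B.bigConst ∧
    max 1 B.qB ≤ B.bigConst ∧ (B.dd : ℝ) + 1 ≤ B.bigConst ∧ siegelConst B.K ≤ B.bigConst ∧
    Real.exp (thetaGrowthC (β := β) B.L B.κM) ≤ B.bigConst ∧ B.thetaLowc⁻¹ ≤ B.bigConst ∧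
    Real.exp B.thetaLowC ≤ B.bigConst ∧ B.dirNorm + 1 ≤ B.bigConst ∧ ‖B.v‖ + 1 ≤ B.bigConst := by
  have h1 : 0 ≤ |(B.d₁ : ℝ)| := abs_nonneg _
  have h2 : 0 ≤ B.M := zero_le_one.trans B.gens.one_le_M
  have h3 : 0 ≤ B.hB := zero_le_one.trans B.one_le_hB
  have h4 : 0 ≤ max 1 B.qB := zero_le_one.trans (le_max_left _ _)
  have h5 : 0 ≤ (B.dd : ℝ) + 1 := by positivity
  have h6 : 0 ≤ siegelConst B.K := zero_le_one.trans (one_le_siegelConst B.K)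
  have h7 : 0 ≤ Real.exp (thetaGrowthC (β := β) B.L B.κM) := Real.exp_nonneg _
  have h8 : 0 ≤ B.thetaLowc⁻¹ := inv_nonneg.mpr B.thetaLow_spec.1.le
  have h9 : 0 ≤ Real.exp B.thetaLowC := Real.exp_nonneg _
  have h10 : 0 ≤ B.dirNorm + 1 := by have := B.dirNorm_nonneg; positivity
  have h11 : 0 ≤ ‖B.v‖ + 1 := by positivity
  unfold bigConst
  refine ⟨?_, ?_, ?_, ?_, ?_, ?_, ?_, ?_, ?_, ?_, ?_, ?_⟩ <;> linarith

/-- `1 ≤ G`. [folklore] -/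
theorem one_le_bigConst : 1 ≤ B.bigConst := by have := B.bigConst_spec.1; linarith

/-! ### Elementary envelope tools -/

/-- `x^N ≤ G^N` for `0 ≤ x ≤ G`. [folklore] -/
theorem pow_le_bigConst_pow {x : ℝ} (hx0 : 0 ≤ x) (hx : x ≤ B.bigConst) (N : ℕ) : x ^ N ≤ B.bigConst ^ N :=
  pow_le_pow_left₀ hx0 hx N

/-- Monotonicity in the exponent: `G^N ≤ G^{N'}` for `N ≤ N'`. [folklore] -/
theorem bigConst_pow_mono {N N' : ℕ} (h : N ≤ N') : B.bigConst ^ N ≤ B.bigConst ^ N' :=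
  pow_le_pow_right₀ B.one_le_bigConst h

/-- `exp(C·y) ≤ G^N` when `e^C ≤ G`, `0 ≤ y ≤ N`. [folklore] -/
theorem exp_mul_le_bigConst_pow {C y : ℝ} (hC : Real.exp C ≤ B.bigConst) (hC0 : 0 ≤ C)
    {N : ℕ} (hy : y ≤ N) : Real.exp (C * y) ≤ B.bigConst ^ N := by
  have hG := B.one_le_bigConst
  calc Real.exp (C * y) ≤ Real.exp (C * N) := Real.exp_le_exp.mpr (mul_le_mul_of_nonneg_left hy hC0)
    _ = Real.exp C ^ N := by rw [← Real.exp_nat_mul, mul_comm]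
    _ ≤ B.bigConst ^ N := pow_le_pow_left₀ (Real.exp_nonneg _) hC N

/-! ### The house bound -/

/-- **Envelope of `houseBound`**: with `D = nD'`, `E_T = expE D T`,
`A ≤ G^{(S₀+1)E_T + 2T + D + (S₀+1)(D·hdeg + 2T)} · W^{T + (D·hdeg + 2T)}`
whenever `D·hdeg + 2T + 1 ≤ W` and `S₀ + 1 ≤ W`. [folklore] -/
theorem houseBound_le (D' T S₀ : ℕ) {W : ℝ} (hW1 : 1 ≤ W)
    (hWT : ((Fintype.card (β ⊕ (γ ⊕ δ)) * D' * B.hdeg : ℕ) : ℝ) + 2 * T + 1 ≤ W)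
    (hWS : (S₀ : ℝ) + 1 ≤ W) :
    B.houseBound D' T S₀ ≤
      B.bigConst ^ ((S₀ + 1) * B.expE (Fintype.card (β ⊕ (γ ⊕ δ)) * D') T + 2 * T +
          Fintype.card (β ⊕ (γ ⊕ δ)) * D' +
          (S₀ + 1) * (Fintype.card (β ⊕ (γ ⊕ δ)) * D' * B.hdeg + 2 * T)) *
        W ^ (T + (Fintype.card (β ⊕ (γ ⊕ δ)) * D' * B.hdeg + 2 * T)) := by
  obtain ⟨hG2, hd1, hM, hhB, hqB, hdd, -⟩ := B.bigConst_spec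
  have hG1 := B.one_le_bigConst
  set n := Fintype.card (β ⊕ (γ ⊕ δ)) with hn
  set D := n * D' with hD
  set ET := B.expE D T with hET
  set P := D * B.hdeg + 2 * T with hP
  unfold houseBound
  rw [← hn, ← hD, ← hET]
  have hG0 : (0 : ℝ) ≤ B.bigConst := by linarith
  have hW0 : (0 : ℝ) ≤ W := by linarith
  have hM1 := B.gens.one_le_M
  have e6 : ((S₀ : ℝ) + 1) * B.M ^ (S₀ + 1) ≤ W * B.bigConst ^ (S₀ + 1) :=
    mul_le_mul hWS (pow_le_pow_left₀ (zero_le_one.trans hM1) hM _) (by positivity) hW0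
  -- factor by factor
  have f1 : (|(B.d₁ : ℝ)|) ^ ((S₀ + 1) * ET) ≤ B.bigConst ^ ((S₀ + 1) * ET) :=
    pow_le_pow_left₀ (abs_nonneg _) hd1 _
  have f2 : ((B.dd : ℝ) + 1) ^ T ≤ B.bigConst ^ T := pow_le_pow_left₀ (by positivity) hdd _
  have f3 : (((D * B.hdeg : ℕ) : ℝ) + 2 * T + 1) ^ T ≤ W ^ T := pow_le_pow_left₀ (by positivity) hWT _
  have f4 : (max 1 B.qB) ^ T ≤ B.bigConst ^ T := pow_le_pow_left₀ (zero_le_one.trans (le_max_left _ _)) hqB _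
  have f5 : B.hB ^ D ≤ B.bigConst ^ D := pow_le_pow_left₀ (zero_le_one.trans B.one_le_hB) hhB _
  have f6 : (((S₀ : ℝ) + 1) * B.M ^ (S₀ + 1)) ^ P ≤ (W * B.bigConst ^ (S₀ + 1)) ^ P :=
    pow_le_pow_left₀ (by positivity) e6 _
  have n1 : (0 : ℝ) ≤ (|(B.d₁ : ℝ)|) ^ ((S₀ + 1) * ET) := by positivity
  have n2 : (0 : ℝ) ≤ ((B.dd : ℝ) + 1) ^ T := by positivity
  have n3 : (0 : ℝ) ≤ (((D * B.hdeg : ℕ) : ℝ) + 2 * T + 1) ^ T := by positivity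
  have n4 : (0 : ℝ) ≤ (max 1 B.qB) ^ T := pow_nonneg (zero_le_one.trans (le_max_left _ _)) _
  have n5 : (0 : ℝ) ≤ B.hB ^ D := pow_nonneg (zero_le_one.trans B.one_le_hB) _
  have n6 : (0 : ℝ) ≤ (((S₀ : ℝ) + 1) * B.M ^ (S₀ + 1)) ^ P := by positivity
  have b1 : (0 : ℝ) ≤ B.bigConst ^ ((S₀ + 1) * ET) := pow_nonneg hG0 _
  have b12 : (0 : ℝ) ≤ B.bigConst ^ ((S₀ + 1) * ET) * B.bigConst ^ T := by positivity
  have b123 : (0 : ℝ) ≤ B.bigConst ^ ((S₀ + 1) * ET) * B.bigConst ^ T * W ^ T := by positivity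
  have b1234 : (0 : ℝ) ≤ B.bigConst ^ ((S₀ + 1) * ET) * B.bigConst ^ T * W ^ T * B.bigConst ^ T := by positivity
  have b12345 : (0 : ℝ) ≤ B.bigConst ^ ((S₀ + 1) * ET) * B.bigConst ^ T * W ^ T * B.bigConst ^ T * B.bigConst ^ D := by
    positivity
  show (|(B.d₁ : ℝ)|) ^ ((S₀ + 1) * ET) * ((B.dd : ℝ) + 1) ^ T * (((D * B.hdeg : ℕ) : ℝ) + 2 * T + 1) ^ T *
      (max 1 B.qB) ^ T * B.hB ^ D * (((S₀ : ℝ) + 1) * B.M ^ (S₀ + 1)) ^ P ≤ _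
  calc (|(B.d₁ : ℝ)|) ^ ((S₀ + 1) * ET) * ((B.dd : ℝ) + 1) ^ T * (((D * B.hdeg : ℕ) : ℝ) + 2 * T + 1) ^ T *
        (max 1 B.qB) ^ T * B.hB ^ D * (((S₀ : ℝ) + 1) * B.M ^ (S₀ + 1)) ^ P
      ≤ B.bigConst ^ ((S₀ + 1) * ET) * B.bigConst ^ T * W ^ T * B.bigConst ^ T * B.bigConst ^ D *
          (W * B.bigConst ^ (S₀ + 1)) ^ P :=
        mul_le_mul (mul_le_mul (mul_le_mul (mul_le_mul (mul_le_mul f1 f2 n2 b1) f3 n3 b12) f4 n4 b123)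
          f5 n5 b1234) f6 n6 b12345
    _ = B.bigConst ^ ((S₀ + 1) * ET + 2 * T + D + (S₀ + 1) * P) * W ^ (T + P) := by
        rw [mul_pow, ← pow_mul]; ring

/-! ### The Siegel house bound and `H_ξ` -/

/-- `x^t ≤ x` for `x ≥ 1` and `0 ≤ t ≤ 1`. [folklore] -/
theorem rpow_le_self_of_one_le {x t : ℝ} (hx : 1 ≤ x) (ht1 : t ≤ 1) : x ^ t ≤ x := by
  calc x ^ t ≤ x ^ (1 : ℝ) := Real.rpow_le_rpow_of_exponent_le hx ht1
    _ = x := Real.rpow_one x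

/-- **Envelope of the Siegel house bound** when `q ≥ 2p` (so the Siegel exponent is `≤ 1`):
`siegelHouseBound ≤ G² · W^n · A`, `A = houseBound`, given `(D'+1)^n ≤ W^n`-type control
`D' + 1 ≤ W`. [folklore] -/
theorem siegelHouseBound_le (D' T S₀ : ℕ) {W : ℝ} (hWD : (D' : ℝ) + 1 ≤ W)
    (hqp : 2 * ((S₀ + 1) * T ^ B.dd) ≤ (D' + 1) ^ Fintype.card (β ⊕ (γ ⊕ δ))) (hp : 0 < (S₀ + 1) * T ^ B.dd) :
    B.siegelHouseBound D' T S₀ ≤ B.bigConst ^ 2 * W ^ Fintype.card (β ⊕ (γ ⊕ δ)) * B.houseBound D' T S₀ := by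
  obtain ⟨hG2, -, -, -, -, -, hCK, -⟩ := B.bigConst_spec
  set n := Fintype.card (β ⊕ (γ ⊕ δ)) with hn
  set p : ℕ := (S₀ + 1) * T ^ B.dd with hp'
  set q : ℕ := (D' + 1) ^ n with hq
  have hA1 := B.one_le_houseBound D' T S₀
  have hC1 := one_le_siegelConst B.K
  have hq1 : (1 : ℝ) ≤ q := by
    have : 1 ≤ q := Nat.one_le_iff_ne_zero.mpr (pow_ne_zero _ (Nat.succ_ne_zero _))
    exact_mod_cast this
  -- the exponent `t = p/(q - p) ∈ [0, 1]`
  have hqp' : (2 : ℝ) * p ≤ q := by exact_mod_cast hqp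
  have hp0 : (0 : ℝ) < p := by exact_mod_cast hp
  set t : ℝ := (p : ℝ) / ((q : ℝ) - p) with ht
  have ht1 : t ≤ 1 := by rw [ht, div_le_one (by linarith)]; linarith
  have hbase : 1 ≤ siegelConst B.K * q * B.houseBound D' T S₀ :=
    one_le_mul_of_one_le_of_one_le (one_le_mul_of_one_le_of_one_le hC1 hq1) hA1
  unfold siegelHouseBound
  rw [← hn, ← hp', ← hq]
  calc siegelConst B.K * (siegelConst B.K * (q : ℝ) * B.houseBound D' T S₀) ^ t
      ≤ siegelConst B.K * (siegelConst B.K * (q : ℝ) * B.houseBound D' T S₀) :=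
        mul_le_mul_of_nonneg_left (rpow_le_self_of_one_le hbase ht1) (zero_le_one.trans hC1)
    _ = siegelConst B.K ^ 2 * (q : ℝ) * B.houseBound D' T S₀ := by ring
    _ ≤ B.bigConst ^ 2 * W ^ n * B.houseBound D' T S₀ := by
        have hqW : (q : ℝ) ≤ W ^ n := by
          rw [hq]; push_cast; exact pow_le_pow_left₀ (by positivity) hWD n
        have hCG : siegelConst B.K ^ 2 ≤ B.bigConst ^ 2 := pow_le_pow_left₀ (zero_le_one.trans hC1) hCK 2
        have : (0 : ℝ) ≤ B.bigConst ^ 2 := by positivity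
        exact mul_le_mul_of_nonneg_right (mul_le_mul hCG hqW (by positivity) this) (zero_le_one.trans hA1)

variable [DecidableEq β] [DecidableEq δ]

/-- **Envelope of `H_ξ`** under the Siegel house bound on the coefficients:
`H_ξ ≤ G³ · W^{2n} · A`. [folklore] -/
theorem houseXi_le {D' T S₀ : ℕ} (ξ : UIdx β γ δ D' → 𝓞 B.K)
    (hξ : ∀ u, house ((ξ u : 𝓞 B.K) : B.K) ≤ B.siegelHouseBound D' T S₀) {W : ℝ} (hW1 : 1 ≤ W)
    (hWD : (D' : ℝ) + 1 ≤ W) (hqp : 2 * ((S₀ + 1) * T ^ B.dd) ≤ (D' + 1) ^ Fintype.card (β ⊕ (γ ⊕ δ)))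
    (hp : 0 < (S₀ + 1) * T ^ B.dd) :
    B.houseXi ξ ≤ B.bigConst ^ 3 * W ^ (2 * Fintype.card (β ⊕ (γ ⊕ δ))) * B.houseBound D' T S₀ := by
  have hG2 := B.bigConst_spec.1
  set n := Fintype.card (β ⊕ (γ ⊕ δ)) with hn
  have hSHB := B.siegelHouseBound_le D' T S₀ hWD hqp hp
  rw [← hn] at hSHB
  have hA1 := B.one_le_houseBound D' T S₀
  have hU : (Fintype.card (UIdx β γ δ D') : ℝ) ≤ W ^ n := by
    rw [card_UIdx]; push_cast; exact pow_le_pow_left₀ (by positivity) hWD n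
  unfold houseXi
  have hsum : ∑ u, house ((ξ u : 𝓞 B.K) : B.K) ≤ (Fintype.card (UIdx β γ δ D') : ℝ) * B.siegelHouseBound D' T S₀ := by
    calc ∑ u, house ((ξ u : 𝓞 B.K) : B.K) ≤ ∑ _u : UIdx β γ δ D', B.siegelHouseBound D' T S₀ :=
          Finset.sum_le_sum fun u _ => hξ u
      _ = _ := by rw [Finset.sum_const, nsmul_eq_mul, Finset.card_univ]
  have hSHB0 : 0 ≤ B.siegelHouseBound D' T S₀ := (house_nonneg _).trans (hξ (fun _ => 0))
  have hWn : (1 : ℝ) ≤ W ^ n := one_le_pow₀ hW1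
  have hX : 1 + (Fintype.card (UIdx β γ δ D') : ℝ) * B.siegelHouseBound D' T S₀ ≤
      W ^ n * (B.bigConst ^ 2 * W ^ n * B.houseBound D' T S₀) + W ^ n * (B.bigConst ^ 2 * W ^ n * B.houseBound D' T S₀) := by
    have h1 : (1 : ℝ) ≤ W ^ n * (B.bigConst ^ 2 * W ^ n * B.houseBound D' T S₀) := by
      refine one_le_mul_of_one_le_of_one_le hWn (one_le_mul_of_one_le_of_one_le
        (one_le_mul_of_one_le_of_one_le (by nlinarith) hWn) hA1)
    have h2 : (Fintype.card (UIdx β γ δ D') : ℝ) * B.siegelHouseBound D' T S₀ ≤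
        W ^ n * (B.bigConst ^ 2 * W ^ n * B.houseBound D' T S₀) :=
      mul_le_mul hU hSHB hSHB0 (by positivity)
    linarith
  calc 1 + ∑ u, house ((ξ u : 𝓞 B.K) : B.K) ≤ 1 + (Fintype.card (UIdx β γ δ D') : ℝ) * B.siegelHouseBound D' T S₀ := by
        linarith
    _ ≤ 2 * (W ^ n * (B.bigConst ^ 2 * W ^ n * B.houseBound D' T S₀)) := by linarith
    _ ≤ B.bigConst * (W ^ n * (B.bigConst ^ 2 * W ^ n * B.houseBound D' T S₀)) :=
        mul_le_mul_of_nonneg_right hG2 (by positivity)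
    _ = B.bigConst ^ 3 * W ^ (2 * n) * B.houseBound D' T S₀ := by ring

/-! ### Denominators, the order loss, the growth factor, the right-hand side -/

omit [DecidableEq β] [DecidableEq δ] in
/-- **Envelope of `|d_s|^E`**: `|d_s|^{E(D,k)} ≤ G^{(S₁+1)·E(D,T')}` for `s ≤ S₁`, `k ≤ T'`. [folklore] -/
theorem dAt_pow_le {D S₁ T' s k : ℕ} (hs : s ≤ S₁) (hk : k ≤ T') :
    |(B.dAt s : ℝ)| ^ B.expE D k ≤ B.bigConst ^ ((S₁ + 1) * B.expE D T') := by
  obtain ⟨-, hd1, -⟩ := B.bigConst_spec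
  have hd1' := B.one_le_abs_d₁
  have e : |(B.dAt s : ℝ)| = |(B.d₁ : ℝ)| ^ (s + 1) := by
    rw [dAt]; push_cast; rw [abs_pow]
  rw [e, ← pow_mul]
  calc |(B.d₁ : ℝ)| ^ ((s + 1) * B.expE D k) ≤ |(B.d₁ : ℝ)| ^ ((S₁ + 1) * B.expE D T') :=
        pow_le_pow_right₀ hd1' (Nat.mul_le_mul (by omega) (B.expE_mono D hk))
    _ ≤ B.bigConst ^ ((S₁ + 1) * B.expE D T') := pow_le_pow_left₀ (abs_nonneg _) hd1 _

omit [DecidableEq β] [DecidableEq δ] in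
/-- **Envelope of the order loss** `k!·(kX+1)^k ≤ (G·W)^{2T'}` for `k ≤ T' ≤ W`. [folklore] -/
theorem orderLoss_le {T' k : ℕ} (hk : k ≤ T') {W : ℝ} (hW1 : 1 ≤ W) (hWT : (T' : ℝ) ≤ W) :
    (k.factorial : ℝ) * ((k : ℝ) * B.dirNorm + 1) ^ k ≤ (B.bigConst * W) ^ (2 * T') := by
  obtain ⟨hG2, -, -, -, -, -, -, -, -, -, hX, -⟩ := B.bigConst_spec
  have hX0 := B.dirNorm_nonneg
  have hG1 := B.one_le_bigConst
  have hGW1 : 1 ≤ B.bigConst * W := one_le_mul_of_one_le_of_one_le hG1 hW1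
  have hkW : (k : ℝ) ≤ W := le_trans (by exact_mod_cast hk) hWT
  -- `k! ≤ k^k ≤ W^k`
  have h1 : (k.factorial : ℝ) ≤ W ^ k := by
    calc (k.factorial : ℝ) ≤ ((k ^ k : ℕ) : ℝ) := by exact_mod_cast Nat.factorial_le_pow k
      _ = (k : ℝ) ^ k := by push_cast; ring
      _ ≤ W ^ k := pow_le_pow_left₀ (Nat.cast_nonneg _) hkW k
  -- `kX + 1 ≤ W·G`
  have h2 : (k : ℝ) * B.dirNorm + 1 ≤ B.bigConst * W := by
    have : (k : ℝ) * B.dirNorm + 1 ≤ W * (B.dirNorm + 1) := by nlinarith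
    calc (k : ℝ) * B.dirNorm + 1 ≤ W * (B.dirNorm + 1) := this
      _ ≤ W * B.bigConst := mul_le_mul_of_nonneg_left hX (by linarith)
      _ = B.bigConst * W := mul_comm _ _
  calc (k.factorial : ℝ) * ((k : ℝ) * B.dirNorm + 1) ^ k ≤ W ^ k * (B.bigConst * W) ^ k :=
        mul_le_mul h1 (pow_le_pow_left₀ (by positivity) h2 k) (by positivity) (by positivity)
    _ ≤ (B.bigConst * W) ^ k * (B.bigConst * W) ^ k := by
        refine mul_le_mul_of_nonneg_right (pow_le_pow_left₀ (by linarith) ?_ k) (by positivity)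
        nlinarith
    _ = (B.bigConst * W) ^ (2 * k) := by rw [← pow_add]; ring_nf
    _ ≤ (B.bigConst * W) ^ (2 * T') := pow_le_pow_right₀ hGW1 (by omega)

omit [DecidableEq β] [DecidableEq δ] in
/-- **Envelope of the growth factor**: with `R ≤ R'` (`R' ∈ ℕ`), `e^{C_Θ D (1 + (R‖v‖+1)²)} ≤ G^{D(1 + (R'+1)² G'²)}`
where `G ≤ G'` (`G' ∈ ℕ`). [folklore] -/
theorem growth_le (D : ℕ) {R : ℝ} (hR0 : 0 ≤ R) {R' G' : ℕ} (hR : R ≤ R') (hG' : B.bigConst ≤ G') :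
    Real.exp (thetaGrowthC (β := β) B.L B.κM * (1 + (R * ‖B.v‖ + 1) ^ 2)) ^ D ≤
      B.bigConst ^ (D * (1 + (R' + 1) ^ 2 * G' ^ 2)) := by
  obtain ⟨hG2, -, -, -, -, -, -, hexp, -, -, -, hv⟩ := B.bigConst_spec
  have hC0 := (thetaGrowthC_spec (β := β) B.L B.κM).1
  have hv0 : 0 ≤ ‖B.v‖ := norm_nonneg _
  have hin : R * ‖B.v‖ + 1 ≤ ((R' : ℝ) + 1) * B.bigConst := by
    have h1 : R * ‖B.v‖ + 1 ≤ (R + 1) * (‖B.v‖ + 1) := by nlinarith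
    calc R * ‖B.v‖ + 1 ≤ (R + 1) * (‖B.v‖ + 1) := h1
      _ ≤ ((R' : ℝ) + 1) * B.bigConst := mul_le_mul (by linarith) hv (by positivity) (by positivity)
  have hsq : (R * ‖B.v‖ + 1) ^ 2 ≤ (((R' : ℝ) + 1) * G') ^ 2 := by
    refine pow_le_pow_left₀ (by positivity) (hin.trans ?_) 2
    exact mul_le_mul_of_nonneg_left hG' (by positivity)
  have hy : 1 + (R * ‖B.v‖ + 1) ^ 2 ≤ ((1 + (R' + 1) ^ 2 * G' ^ 2 : ℕ) : ℝ) := by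
    push_cast; nlinarith
  rw [← Real.exp_nat_mul]
  rw [show (D : ℝ) * (thetaGrowthC (β := β) B.L B.κM * (1 + (R * ‖B.v‖ + 1) ^ 2)) =
      thetaGrowthC (β := β) B.L B.κM * ((D : ℝ) * (1 + (R * ‖B.v‖ + 1) ^ 2)) from by ring]
  refine B.exp_mul_le_bigConst_pow hexp hC0 ?_
  push_cast
  exact mul_le_mul_of_nonneg_left (by exact_mod_cast hy) (Nat.cast_nonneg D)

omit [DecidableEq β] [DecidableEq δ] in
/-- **Lower envelope of the right-hand side**: `G^{-D(2+s²)} ≤ (c_Θ e^{-C'_Θ(1+s²)})^D`. [folklore] -/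
theorem rhs_ge (D s : ℕ) :
    (B.bigConst ^ (D * (2 + s ^ 2)))⁻¹ ≤ (B.thetaLowc * Real.exp (-(B.thetaLowC * (1 + (s : ℝ) ^ 2)))) ^ D := by
  obtain ⟨hG2, -, -, -, -, -, -, -, hcinv, hCexp, -⟩ := B.bigConst_spec
  obtain ⟨hc0, hC'0, -⟩ := B.thetaLow_spec
  have hG1 := B.one_le_bigConst
  have hG0 : 0 < B.bigConst := by linarith
  -- `c_Θ ≥ 1/G` and `e^{-C'(1+s²)} ≥ G^{-(1+s²)}`
  have h1 : B.bigConst⁻¹ ≤ B.thetaLowc := by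
    rw [inv_le_comm₀ hG0 hc0]; exact hcinv
  have h2 : (B.bigConst ^ (1 + s ^ 2))⁻¹ ≤ Real.exp (-(B.thetaLowC * (1 + (s : ℝ) ^ 2))) := by
    rw [Real.exp_neg, inv_le_inv₀ (by positivity) (Real.exp_pos _)]
    calc Real.exp (B.thetaLowC * (1 + (s : ℝ) ^ 2)) = Real.exp B.thetaLowC ^ (1 + s ^ 2) := by
          rw [← Real.exp_nat_mul]; push_cast; ring_nf
      _ ≤ B.bigConst ^ (1 + s ^ 2) := pow_le_pow_left₀ (Real.exp_nonneg _) hCexp _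
  calc (B.bigConst ^ (D * (2 + s ^ 2)))⁻¹ = (B.bigConst⁻¹ * (B.bigConst ^ (1 + s ^ 2))⁻¹) ^ D := by
        rw [← mul_inv, ← pow_succ', inv_pow, ← pow_mul]
        congr 2; ring
    _ ≤ (B.thetaLowc * Real.exp (-(B.thetaLowC * (1 + (s : ℝ) ^ 2)))) ^ D :=
        pow_le_pow_left₀ (by positivity) (mul_le_mul h1 h2 (by positivity) hc0.le) D

/-! ### The Liouville bound `Λ` and the saving factor -/

/-- **Envelope of `lineValBound`**: for `s ≤ S₁`, `k ≤ T'`, under the Siegel house bound,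
`Λ_{s,k} ≤ G^{2T' + 3 + D + (S₁+1)P₁} · W^{2T' + 3n + P₁} · A`, `P₁ = D·hdeg + 2T'`, `A = houseBound`.
[folklore] -/
theorem lineValBound_le {D' T S₀ S₁ T' : ℕ} (ξ : UIdx β γ δ D' → 𝓞 B.K)
    (hξ : ∀ u, house ((ξ u : 𝓞 B.K) : B.K) ≤ B.siegelHouseBound D' T S₀) {W : ℝ} (hW1 : 1 ≤ W)
    (hWD : (D' : ℝ) + 1 ≤ W) (hqp : 2 * ((S₀ + 1) * T ^ B.dd) ≤ (D' + 1) ^ Fintype.card (β ⊕ (γ ⊕ δ)))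
    (hp : 0 < (S₀ + 1) * T ^ B.dd) (hWT' : (T' : ℝ) ≤ W)
    (hWP : ((Fintype.card (β ⊕ (γ ⊕ δ)) * D' * B.hdeg : ℕ) : ℝ) + 2 * T' ≤ W) (hWS : (S₁ : ℝ) + 1 ≤ W)
    {s k : ℕ} (hs : s ≤ S₁) (hk : k ≤ T') :
    B.lineValBound ξ s k ≤
      B.bigConst ^ (2 * T' + 3 + Fintype.card (β ⊕ (γ ⊕ δ)) * D' +
          (S₁ + 1) * (Fintype.card (β ⊕ (γ ⊕ δ)) * D' * B.hdeg + 2 * T')) *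
        W ^ (2 * T' + 3 * Fintype.card (β ⊕ (γ ⊕ δ)) + (Fintype.card (β ⊕ (γ ⊕ δ)) * D' * B.hdeg + 2 * T')) *
        B.houseBound D' T S₀ := by
  obtain ⟨hG2, -, hM, hhB, hqB, hdd, -⟩ := B.bigConst_spec
  have hG1 := B.one_le_bigConst
  have hG0 : (0 : ℝ) ≤ B.bigConst := by linarith
  have hW0 : (0 : ℝ) ≤ W := by linarith
  set n := Fintype.card (β ⊕ (γ ⊕ δ)) with hn
  set D := n * D' with hD
  set P₁ := D * B.hdeg + 2 * T' with hP₁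
  have hA1 := B.one_le_houseBound D' T S₀
  have hHξ := B.houseXi_le ξ hξ hW1 hWD hqp hp
  rw [← hn] at hHξ
  have hkW : (k : ℝ) ≤ W := le_trans (by exact_mod_cast hk) hWT'
  have hU : (Fintype.card (UIdx β γ δ D') : ℝ) ≤ W ^ n := by
    rw [card_UIdx]; push_cast; exact pow_le_pow_left₀ (by positivity) hWD n
  -- the factors
  have f1 : (B.dd : ℝ) ^ k ≤ B.bigConst ^ T' :=
    (pow_le_pow_left₀ (Nat.cast_nonneg _) (by linarith : (B.dd : ℝ) ≤ B.bigConst) k).trans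
      (pow_le_pow_right₀ hG1 hk)
  have f2 : (k : ℝ) ^ k ≤ W ^ T' := (pow_le_pow_left₀ (Nat.cast_nonneg _) hkW k).trans (pow_le_pow_right₀ hW1 hk)
  have f5 : (((D * B.hdeg : ℕ) : ℝ) + 2 * k) ^ k ≤ W ^ T' := by
    have : ((D * B.hdeg : ℕ) : ℝ) + 2 * k ≤ W := by
      have : (k : ℝ) ≤ T' := by exact_mod_cast hk
      rw [hD]; linarith
    exact (pow_le_pow_left₀ (by positivity) this k).trans (pow_le_pow_right₀ hW1 hk)
  have f6 : B.qB ^ k ≤ B.bigConst ^ T' :=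
    ((pow_le_pow_left₀ B.qB_nonneg ((le_max_right 1 B.qB).trans hqB) k)).trans (pow_le_pow_right₀ hG1 hk)
  have f7 : B.hB ^ D ≤ B.bigConst ^ D := pow_le_pow_left₀ (zero_le_one.trans B.one_le_hB) hhB _
  have hsM1 : (1 : ℝ) ≤ ((s : ℝ) + 1) * B.M ^ (s + 1) :=
    one_le_mul_of_one_le_of_one_le (by have : (0:ℝ) ≤ s := Nat.cast_nonneg s; linarith) (one_le_pow₀ B.gens.one_le_M)
  have hM0 : (0 : ℝ) ≤ B.M := zero_le_one.trans B.gens.one_le_M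
  have hsM : ((s : ℝ) + 1) * B.M ^ (s + 1) ≤ W * B.bigConst ^ (S₁ + 1) := by
    have hsS : (s : ℝ) ≤ S₁ := by exact_mod_cast hs
    have h1 : (s : ℝ) + 1 ≤ W := by linarith
    have h2 : B.M ^ (s + 1) ≤ B.bigConst ^ (S₁ + 1) :=
      (pow_le_pow_left₀ hM0 hM _).trans (pow_le_pow_right₀ hG1 (by omega))
    exact mul_le_mul h1 h2 (pow_nonneg hM0 _) hW0
  have hsM0 : (0 : ℝ) ≤ ((s : ℝ) + 1) * B.M ^ (s + 1) := mul_nonneg (by positivity) (pow_nonneg hM0 _)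
  have f8 : (((s : ℝ) + 1) * B.M ^ (s + 1)) ^ (D * B.hdeg + 2 * k) ≤ (W * B.bigConst ^ (S₁ + 1)) ^ P₁ :=
    (pow_le_pow_left₀ hsM0 hsM _).trans (pow_le_pow_right₀ (by
      calc (1 : ℝ) ≤ ((s : ℝ) + 1) * B.M ^ (s + 1) := hsM1
        _ ≤ W * B.bigConst ^ (S₁ + 1) := hsM) (by rw [hP₁]; omega))
  -- nonnegativity
  have n1 : (0 : ℝ) ≤ (B.dd : ℝ) ^ k := by positivity
  have n2 : (0 : ℝ) ≤ (k : ℝ) ^ k := by positivity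
  have n3 : (0 : ℝ) ≤ (Fintype.card (UIdx β γ δ D') : ℝ) := Nat.cast_nonneg _
  have n4 : (0 : ℝ) ≤ B.houseXi ξ := zero_le_one.trans (B.one_le_houseXi ξ)
  have n5 : (0 : ℝ) ≤ (((D * B.hdeg : ℕ) : ℝ) + 2 * k) ^ k := by positivity
  have n6 : (0 : ℝ) ≤ B.qB ^ k := pow_nonneg B.qB_nonneg _
  have n7 : (0 : ℝ) ≤ B.hB ^ D := pow_nonneg (zero_le_one.trans B.one_le_hB) _
  have n8 : (0 : ℝ) ≤ (((s : ℝ) + 1) * B.M ^ (s + 1)) ^ (D * B.hdeg + 2 * k) := pow_nonneg hsM0 _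
  unfold lineValBound
  rw [← hn, ← hD]
  calc (B.dd : ℝ) ^ k * (k : ℝ) ^ k * (Fintype.card (UIdx β γ δ D') : ℝ) * B.houseXi ξ *
        ((((D * B.hdeg : ℕ) : ℝ) + 2 * k) ^ k * B.qB ^ k * B.hB ^ D *
          (((s : ℝ) + 1) * B.M ^ (s + 1)) ^ (D * B.hdeg + 2 * k))
      ≤ B.bigConst ^ T' * W ^ T' * W ^ n * (B.bigConst ^ 3 * W ^ (2 * n) * B.houseBound D' T S₀) *
          (W ^ T' * B.bigConst ^ T' * B.bigConst ^ D * (W * B.bigConst ^ (S₁ + 1)) ^ P₁) := by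
        refine mul_le_mul (mul_le_mul (mul_le_mul (mul_le_mul f1 f2 n2 (by positivity)) hU n3 (by positivity))
          hHξ n4 (by positivity)) (mul_le_mul (mul_le_mul (mul_le_mul f5 f6 n6 (by positivity)) f7 n7
          (by positivity)) f8 n8 (by positivity)) (by positivity) (by positivity)
    _ = B.bigConst ^ (2 * T' + 3 + D + (S₁ + 1) * P₁) * W ^ (2 * T' + 3 * n + P₁) * B.houseBound D' T S₀ := by
        rw [mul_pow, ← pow_mul]; ring

omit [DecidableEq β] [DecidableEq δ] in
/-- **The saving factor**: if `2(S₁ + S₀)/R ≤ θ ≤ 1` then for `s ≤ S₁`, `k ≤ T'`,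
`(2(s+S₀)/R)^{(T-k)(S₀+1)} ≤ θ^{(T-T')(S₀+1)}`. [folklore] -/
theorem saving_le {S₀ S₁ T T' : ℕ} {R θ : ℝ} (hR : 0 < R) (hθ : 2 * ((S₁ : ℝ) + S₀) / R ≤ θ) (hθ1 : θ ≤ 1)
    {s k : ℕ} (hs : s ≤ S₁) (hk : k ≤ T') :
    (2 * ((s : ℝ) + S₀) / R) ^ ((T - k) * (S₀ + 1)) ≤ θ ^ ((T - T') * (S₀ + 1)) := by
  have hb0 : 0 ≤ 2 * ((s : ℝ) + S₀) / R := by positivity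
  have hb : 2 * ((s : ℝ) + S₀) / R ≤ θ := by
    refine le_trans (div_le_div_of_nonneg_right ?_ hR.le) hθ
    have : (s : ℝ) ≤ S₁ := by exact_mod_cast hs
    linarith
  have hθ0 : 0 ≤ θ := hb0.trans hb
  calc (2 * ((s : ℝ) + S₀) / R) ^ ((T - k) * (S₀ + 1)) ≤ θ ^ ((T - k) * (S₀ + 1)) := pow_le_pow_left₀ hb0 hb _
    _ ≤ θ ^ ((T - T') * (S₀ + 1)) := pow_le_pow_of_le_one hθ0 hθ1 (Nat.mul_le_mul_right _ (by omega))

end BakerData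

end Std

end GaGmE

end Literature.NumberTheory.Transcendental

end
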